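import Summits.HubbardSuperconductivity.HubbardSuperconductivity.Theorems.AnisotropyChordKnnComparison
import Summits.HubbardSuperconductivity.HubbardSuperconductivity.Theorems.AnisotropyChordKnnBlock

/-!
# Route `AnisotropyChord` / H0 rotor rung, K_{n,n} sibling of XY-LM₀: LEMMA R — the budget condition (S_M) gives the
# link `g(M) ≤ g(M+1)` (Lean port of theory seat `hubbard-h0-rotor-theory-1`'s THEOREMS M14 with the monotone facts
# (F2)–(F4) of M12; memo ROTOR-THEORY-11 §163)

For `0 ≤ M` with `M + 2 ≤ 2s` the level sets are nested, `𝒥_{M+1} ⊆ 𝒥_M` (equal, or the bottom level dropped: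
`shift`), the couplings shrink (`cK_succ_le`, F4) and the diagonal drops by
`d_J(M) = p_J(M) − p_J(M+1) = (η/4)(2M+1)(β²_{J−1} + β²_J) ≥ d_{2s−2}(M)` on every non-top level (F2, F3, F1).
Hence, if the Perron roots satisfy the BUDGET CONDITION (S_M) `λ(M) − λ(M+1) ≤ d_{2s−2}(M)` (`BudgetCondition`), the
Riccati comparison of `…KnnComparison` yields MLR dominance of the top vectors and `casimirMean` climbs:
`casimirMean_le_succ_of_budget`.  (S_M) itself is certified numerically elsewhere (`…KnnCertificate`, `…KnnXYPoint`).
-/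

set_option linter.dupNamespace false
set_option autoImplicit false

noncomputable section

open Finset Matrix

namespace Summit.HubbardSuperconductivity.HubbardSuperconductivity.Theorems.AnisotropyChord.Knn

/-! ## The `M ↦ M + 1` shift of the level set -/

/-- number of bottom levels of `𝒥_M` missing from `𝒥_{M+1}` (`1` if `|M| ≡ 2s (mod 2)`, else `0`). [folklore] -/
def shift (twoS M : ℕ) : ℕ := if M % 2 = twoS % 2 then 1 else 0

/-- `natAbs` of the successor sector. [folklore] -/
theorem natAbs_natCast_succ (M : ℕ) : ((M : ℤ) + 1).natAbs = M + 1 := by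
  have : (M : ℤ) + 1 = ((M + 1 : ℕ) : ℤ) := by push_cast; ring
  rw [this, Int.natAbs_natCast]

/-- `jMin(M+1) = jMin(M) + 2·shift`. [folklore] -/
theorem jMin_succ (twoS M : ℕ) : jMin twoS ((M : ℤ) + 1) = jMin twoS (M : ℤ) + 2 * shift twoS M := by
  unfold jMin shift
  rw [natAbs_natCast_succ, Int.natAbs_natCast]
  split_ifs <;> omega

/-- `numLevels(M) = numLevels(M+1) + shift` (for `M + 1 ≤ 2s`). [folklore] -/
theorem numLevels_succ (twoS M : ℕ) (hM : M + 1 ≤ twoS) :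
    numLevels twoS (M : ℤ) = numLevels twoS ((M : ℤ) + 1) + shift twoS M := by
  have h1 := jMin_succ twoS M
  have h2 : jMin twoS ((M : ℤ) + 1) ≤ twoS := jMin_le twoS (by rw [natAbs_natCast_succ]; exact hM)
  have h3 := jMin_mod_two twoS (M : ℤ)
  unfold numLevels
  unfold shift at h1 ⊢
  split_ifs at h1 ⊢ <;> omega

/-- `lev(M+1) k = lev(M) (k + shift)`. [folklore] -/
theorem lev_succ (twoS M k : ℕ) : lev twoS ((M : ℤ) + 1) k = lev twoS (M : ℤ) (k + shift twoS M) := by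
  unfold lev; rw [jMin_succ]; ring

/-- `fK(M+1) k = fK(M) (k + shift)`. [folklore] -/
theorem fK_succ (twoS M k : ℕ) : fK twoS ((M : ℤ) + 1) k = fK twoS (M : ℤ) (k + shift twoS M) := by
  unfold fK; rw [lev_succ]

/-! ## (F4) couplings shrink, (F2)/(F3) the diagonal drop dominates the budget -/

/-- **(F4)** `c_k(M+1) ≤ c_{k+shift}(M)` (same level `J`; `b_J²` antitone in `|M|`). [folklore] -/
theorem cK_succ_le (twoS M : ℕ) {η : ℝ} (hη : 0 ≤ η) (k : ℕ) :
    cK twoS ((M : ℤ) + 1) η k ≤ cK twoS (M : ℤ) η (k + shift twoS M) := by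
  unfold cK
  rw [lev_succ]
  set J := lev twoS (M : ℤ) (k + shift twoS M) with hJ
  have habs : |(M : ℤ)| ≤ |(M : ℤ) + 1| := by
    rw [abs_of_nonneg (by positivity), abs_of_nonneg (by positivity)]; linarith
  have hMJ : ((M : ℤ) + 1).natAbs ≤ J := by
    have := natAbs_le_lev twoS ((M : ℤ) + 1) k
    rw [lev_succ] at this; exact this
  apply mul_le_mul_of_nonneg_left _ (by positivity)
  apply Real.sqrt_le_sqrt
  exact mul_le_mul (bSq_antitone_abs habs J) (bSq_antitone_abs habs (J + 1))
    (bSq_nonneg (by omega)) ((bSq_nonneg (by omega)).trans (bSq_antitone_abs habs J))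

/-- the `J`-independent budget `d_{2s−2}(M) = (η/4)(2M+1)(β²_{2s−3} + β²_{2s−2})` of (S_M). [folklore] -/
def budget (twoS M : ℕ) (η : ℝ) : ℝ :=
  η / 4 * (2 * (M : ℝ) + 1) * (betaSq twoS (twoS - 3) + betaSq twoS (twoS - 2))

/-- **(F2)** `b_J(M)² − b_J(M+1)² = (2M+1) β_J²` inside the range, `0` outside. [folklore] -/
theorem bSq_sub_bSq_succ (twoS M J : ℕ) :
    bSq twoS (M : ℤ) J - bSq twoS ((M : ℤ) + 1) J = if J + 1 ≤ twoS then (2 * (M : ℝ) + 1) * betaSq twoS J else 0 := by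
  unfold bSq
  split_ifs with h
  · push_cast; ring
  · simp

/-- **(F2)+(F3)+(F1): the diagonal drop on a NON-TOP level dominates the budget,**
`budget ≤ p_{k+shift}(M) − p_k(M+1)` for `lev(M+1) k + 2 ≤ 2s`. [folklore] -/
theorem budget_le_pK_sub (twoS M : ℕ) {η : ℝ} (hη : 0 ≤ η) {k : ℕ}
    (hk : lev twoS ((M : ℤ) + 1) k + 2 ≤ twoS) :
    budget twoS M η ≤ pK twoS (M : ℤ) η (k + shift twoS M) - pK twoS ((M : ℤ) + 1) η k := by
  have hJ1 : M + 1 ≤ lev twoS ((M : ℤ) + 1) k := by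
    have := natAbs_le_lev twoS ((M : ℤ) + 1) k
    rwa [natAbs_natCast_succ] at this
  unfold pK
  rw [← lev_succ]
  set J := lev twoS ((M : ℤ) + 1) k with hJdef
  -- the drop, level by level
  have hdrop : (↑J * (↑J + 1) / 2 + η / 4 * (bSqPred twoS (↑M) J + bSq twoS (↑M) J))
      - (↑J * (↑J + 1) / 2 + η / 4 * (bSqPred twoS (↑M + 1) J + bSq twoS (↑M + 1) J))
      = η / 4 * ((bSqPred twoS (M : ℤ) J - bSqPred twoS ((M : ℤ) + 1) J)
          + (bSq twoS (M : ℤ) J - bSq twoS ((M : ℤ) + 1) J)) := by ring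
  rw [hdrop]
  have hJ0 : J ≠ 0 := by omega
  have e1 : bSqPred twoS (M : ℤ) J - bSqPred twoS ((M : ℤ) + 1) J = (2 * (M : ℝ) + 1) * betaSq twoS (J - 1) := by
    unfold bSqPred
    rw [if_neg hJ0, if_neg hJ0, bSq_sub_bSq_succ, if_pos (by omega)]
  have e2 : bSq twoS (M : ℤ) J - bSq twoS ((M : ℤ) + 1) J = (2 * (M : ℝ) + 1) * betaSq twoS J := by
    rw [bSq_sub_bSq_succ, if_pos (by omega)]
  rw [e1, e2]
  unfold budget
  have hb1 : betaSq twoS (twoS - 3) ≤ betaSq twoS (J - 1) := betaSq_antitone (by omega) (by omega)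
  have hb2 : betaSq twoS (twoS - 2) ≤ betaSq twoS J := betaSq_antitone (by omega) (by omega)
  have hM0 : (0 : ℝ) ≤ 2 * (M : ℝ) + 1 := by positivity
  have : betaSq twoS (twoS - 3) + betaSq twoS (twoS - 2) ≤ betaSq twoS (J - 1) + betaSq twoS J := by linarith
  calc η / 4 * (2 * (M : ℝ) + 1) * (betaSq twoS (twoS - 3) + betaSq twoS (twoS - 2))
      ≤ η / 4 * (2 * (M : ℝ) + 1) * (betaSq twoS (J - 1) + betaSq twoS J) :=
        mul_le_mul_of_nonneg_left this (by positivity)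
    _ = η / 4 * ((2 * (M : ℝ) + 1) * betaSq twoS (J - 1) + (2 * (M : ℝ) + 1) * betaSq twoS J) := by ring

/-! ## (S_M): the budget condition, and LEMMA R -/

/-- **THE BUDGET CONDITION (S_M)** of the theory seat's LEMMA R (THEOREMS M14/M15): the Perron roots of adjacent blocks
drop by at most `d_{2s−2}(M)`: `λ_max(P_M(η)) − λ_max(P_{M+1}(η)) ≤ (η/4)(2M+1)(β²_{2s−3} + β²_{2s−2})`, phrased through
the Rayleigh quotients of the variational top vectors.  Numerically `≤ 0.28 × budget` on `η ∈ (0,1]` (memo §163);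
certified instances: `…KnnXYPoint`. [conjecture: theory seat hubbard-h0-rotor-theory-1, cycle 11 — hypothesis (S_M)] -/
def BudgetCondition (twoS M : ℕ) (η : ℝ) : Prop :=
  ∀ x x', IsTopVector (knnBlock twoS (M : ℤ) η) x → IsTopVector (knnBlock twoS ((M : ℤ) + 1) η) x' →
    rayleigh (knnBlock twoS (M : ℤ) η) x - rayleigh (knnBlock twoS ((M : ℤ) + 1) η) x' ≤ budget twoS M η

/-- **LEMMA R (theory seat THEOREMS M14), Lean:** for `0 ≤ M`, `M + 2 ≤ 2s`, `η > 0`, the budget condition (S_M) implies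
the XY-Lieb–Mattis link `g(M) ≤ g(M+1)` on `K_{n,n}`: `⟨J(J+1)⟩` in the top vector of `P_M(η)` is at most that of
`P_{M+1}(η)`.  Proof: nested level sets, coupling dominance (F4), diagonal drop ≥ budget (F1–F3), Riccati comparison
⇒ adjacent ratio dominance ⇒ MLR ⇒ means of the increasing level function `J(J+1)` climb.
[conjecture: theory seat hubbard-h0-rotor-theory-1, cycle 11 — LEMMA R (M14), paper-proved; Lean proof here] -/
theorem casimirMean_le_succ_of_budget {twoS M : ℕ} (hM : M + 2 ≤ twoS) {η : ℝ} (hη : 0 < η)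
    (hB : BudgetCondition twoS M η) {x : Fin (numLevels twoS (M : ℤ)) → ℝ}
    {x' : Fin (numLevels twoS ((M : ℤ) + 1)) → ℝ}
    (hx : IsTopVector (knnBlock twoS (M : ℤ) η) x) (hx' : IsTopVector (knnBlock twoS ((M : ℤ) + 1) η) x') :
    casimirMean twoS (M : ℤ) x ≤ casimirMean twoS ((M : ℤ) + 1) x' := by
  have hbud := hB x x' hx hx'
  simp only [knnBlock_eq_jac] at hx hx' hbud
  have hms : numLevels twoS (M : ℤ) = numLevels twoS ((M : ℤ) + 1) + shift twoS M :=
    numLevels_succ twoS M (by omega)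
  have hMabs : ((M : ℤ)).natAbs ≤ twoS := by rw [Int.natAbs_natCast]; omega
  have hM1abs : ((M : ℤ) + 1).natAbs ≤ twoS := by rw [natAbs_natCast_succ]; omega
  -- eigen-rows, positivity
  have hrow : ∀ j, j < numLevels twoS (M : ℤ) →
      rayleigh (jac (numLevels twoS (M : ℤ)) (pK twoS (M : ℤ) η) (cK twoS (M : ℤ) η)) x * ext0 x j
        = pK twoS (M : ℤ) η j * ext0 x j + cK twoS (M : ℤ) η j * ext0 x (j + 1)
          + (if j = 0 then 0 else cK twoS (M : ℤ) η (j - 1) * ext0 x (j - 1)) :=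
    fun j hj => eigen_row_of_isTopVector hx ⟨j, hj⟩
  have hrow' : ∀ k, k < numLevels twoS ((M : ℤ) + 1) →
      rayleigh (jac (numLevels twoS ((M : ℤ) + 1)) (pK twoS ((M : ℤ) + 1) η) (cK twoS ((M : ℤ) + 1) η)) x'
          * ext0 x' k
        = pK twoS ((M : ℤ) + 1) η k * ext0 x' k + cK twoS ((M : ℤ) + 1) η k * ext0 x' (k + 1)
          + (if k = 0 then 0 else cK twoS ((M : ℤ) + 1) η (k - 1) * ext0 x' (k - 1)) :=
    fun k hk => eigen_row_of_isTopVector hx' ⟨k, hk⟩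
  have hc : ∀ j, j + 1 < numLevels twoS (M : ℤ) → 0 < cK twoS (M : ℤ) η j := fun j hj => cK_pos hMabs hη hj
  have hc' : ∀ k, k + 1 < numLevels twoS ((M : ℤ) + 1) → 0 < cK twoS ((M : ℤ) + 1) η k :=
    fun k hk => cK_pos hM1abs hη hk
  have he : ∀ j, j < numLevels twoS (M : ℤ) → 0 < ext0 x j := by
    intro j hj; rw [ext0_of_lt x hj]; exact isTopVector_pos hc hx ⟨j, hj⟩
  have he' : ∀ k, k < numLevels twoS ((M : ℤ) + 1) → 0 < ext0 x' k := by
    intro k hk; rw [ext0_of_lt x' hk]; exact isTopVector_pos hc' hx' ⟨k, hk⟩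
  have henn : ∀ j, 0 ≤ ext0 x j := ext0_nonneg_of_isTopVector hx
  have henn' : ∀ k, 0 ≤ ext0 x' k := ext0_nonneg_of_isTopVector hx'
  -- (H1) budget on non-top rows, (H2) coupling dominance
  have H1 : ∀ k, k + 1 < numLevels twoS ((M : ℤ) + 1) →
      rayleigh (jac (numLevels twoS (M : ℤ)) (pK twoS (M : ℤ) η) (cK twoS (M : ℤ) η)) x
          - pK twoS (M : ℤ) η (k + shift twoS M)
        ≤ rayleigh (jac (numLevels twoS ((M : ℤ) + 1)) (pK twoS ((M : ℤ) + 1) η) (cK twoS ((M : ℤ) + 1) η)) x'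
          - pK twoS ((M : ℤ) + 1) η k := by
    intro k hk
    have hlev : lev twoS ((M : ℤ) + 1) k + 2 ≤ twoS := lev_add_two_le twoS hM1abs hk
    have hd := budget_le_pK_sub twoS M hη.le hlev
    linarith
  have H2 : ∀ k, k + 1 < numLevels twoS ((M : ℤ) + 1) →
      cK twoS ((M : ℤ) + 1) η k ≤ cK twoS (M : ℤ) η (k + shift twoS M) :=
    fun k _ => cK_succ_le twoS M hη.le k
  have hric := riccati_compare hms hrow hrow' he he' henn hc H1 H2
  have hadj := adjacent_of_riccati hric hc' H2 henn henn'
  -- means climb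
  have hmono : ∀ k l, k ≤ l → l < numLevels twoS ((M : ℤ) + 1) + shift twoS M →
      fK twoS (M : ℤ) k ≤ fK twoS (M : ℤ) l :=
    fun k l hkl _ => fK_mono twoS (M : ℤ) hkl
  have he2 : ∀ j, j < numLevels twoS ((M : ℤ) + 1) + shift twoS M → 0 < ext0 x j := by rw [← hms]; exact he
  have key := mean_le_mean_of_adjacent (numLevels_pos twoS _) (ext0 x) (ext0 x') (fK twoS (M : ℤ))
    he2 he' hmono hadj
  rw [← hms] at key
  rw [casimirMean_eq, casimirMean_eq]
  have ef : ∀ k, fK twoS ((M : ℤ) + 1) k = fK twoS (M : ℤ) (k + shift twoS M) := fun k => fK_succ twoS M k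
  simp only [ef]
  exact key

end Summit.HubbardSuperconductivity.HubbardSuperconductivity.Theorems.AnisotropyChord.Knn
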